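import Summits.QuantumFields.BalabanUV.Beta.FP.PeriodisedBorderWardContactTwo
import Summits.QuantumFields.BalabanUV.Beta.FP.TorusCompositeCovarianceOne

/-!
# `BalabanUV.Beta.FP.TorusCompositeCovarianceTwoStep` — road «FP» for binder row D1, ROUTE T, the OWNER d1-p3's SPEC-27 «THE (j, m) TORUS CALL FOR m ≥ 2»,
# **(COV-m) ORDER 2 AT EVERY DEPTH, PART 1 — THE ONE-STEP SECOND-ORDER INSERTION JET ALONG A BOND WEIGHT AND ITS GAUGE-COVARIANCE LAW ON ALL COLUMNS**:
# `stepIns₂ w · D_fine = 2•stepIns₁ w · Tip(w) − c_ℓ•Qstep · Tip(w⊙w) + c_ℓ²•Far((Qstep w)⊙(Qstep w))` (the brick of the composite tower's second chain rule,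
# PART 2 `FP/TorusCompositeCovarianceTwo`; the order-2 twin of C1 `TorusCompositeCovarianceOne.stepIns₁_mul_tgrad`)

WHY (g24 HANDOFF OPEN (3); MEMO-g24 §3 (ii)).  #21's composite torus call displays its order-2 covariance rows `c2 ∕ d2` with FREE matrices `Q₁₂ Q₂₂`; an1's records hold
only ONE-STEP tables, so — exactly as at order 1 (C1∕C2) — the composite second-order insertion jet is DEFINED by a recursion over one-step jets, and the one-step brick
is the rooted second-order border pair periodised on the fine torus.  This file types the brick at the matrix level and proves the ONE identity the recursion consumes.

WHAT.  [our object — bookkeeping] **`stepIns₂ M Lc r w`** := `Σ_b Σ_{b′} (w b·w b′) • perF (dper (½(vh₂SAt ρ b b′_n + vh₂SAt ρ b′_n b)))∘((coarsePt, inr), (·, inl))` (root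
`ρ = toSite r`; the SYMMETRISED rooted packed pair of an1's second-order border table, periodised in its second bond — `FP/PeriodisedBorderWardContactTwo` — inserted
TWICE along the bond weight `w`; C1's slot maps; level-free).  [folklore] `stepIns₁_apply` (C1's jet entrywise), `ite_bond_eq`, the finite algebra `step_entry_algebra`,
and **`stepIns₂_mul_tgrad`** (ALL gauge columns, `r ∈ box`, ANY level `ℓ` on the right): `stepIns₂ w · D_fine = 2 • (stepIns₁ w · Tip(w)) − c_ℓ • (Qstep_ℓ · Tip(w⊙w))
+ c_ℓ² • Far((Qstep_ℓ w)⊙(Qstep_ℓ w))` — the two bonds' TIP contacts each read C1's first-order jet (hence the `2`), the diagonal reads the averaging rows on the SQUARED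
weight, the FAR-ROOT contact `Far(v)(a, s) = v a · [s = rootPt (a.1 + e_{a.2})]` carries the SQUARE of the averaged weight (`Tip(v)(b, s) = v b · [s ≡ b.1 + e_{b.2}]`,
`c_ℓ = (Lc^{d+1}·stepScale d Lc ℓ)⁻¹` as in C1).  One bookkeeping def + [folklore] finite sums BY NAME; no `def … : Prop`, nothing cited, 0 sorry.  Nothing of the
dictionary ∕ Bałaban's asserted (that this IS the one-step averaging's second jet along `w` is an2's TABLE word; the symmetrisation is immaterial on the diagonal and
kills the antisymmetric `hessKerAt` part — `Beta/BorderGaugeLegContactTwo` §3).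

HONEST DEPENDENCY (page 1, mandatory): continuum YM on T⁴ ⇐ BetaPertH ∧ nine spine estimates (0/9 proved); BetaPertH ⇐ (D1) ∧ (D4) ∧ CAP+tail;
G-an2-4 gates asym, D1 and NE2/3/4.  HONEST FRAMING (cell contract, verbatim): «discharging `BetaPertH` makes Bałaban's UV stability UNCONDITIONAL —
a real constructive-QFT result; it is NOT the continuum limit and NOT the Clay problem.»  ABSOLUTE RULE (cell charter, verbatim): «No internally-minted
statement may enter as a cited fact. Every hypothesis is either kernel-proved in this package or a verbatim quotation of a PUBLISHED theorem with page
reference. The manuscript(s) under audit are NOT citable for their own disputed steps — they are the thing under adjudication; programme-internal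
(2001/route/tribunal) claims are never citable.»  0 estimates; 0∕4 row-D1 binders; NOT (T-ID), NOT SDF, NOT D1, NOT BetaPertH, NOT continuum, NOT Clay.
D1 formalisation swarm LEAF PROVER 02 (b2b-balaban-beta-d1-formalise-leaf-02 gen 25), 2026-08-23.  No existing file touched.
-/

noncomputable section

open scoped BigOperators

namespace Summit.QuantumFields.BalabanUV.Beta.FP.TorusCompositeCovarianceTwoStep

open Matrix Finset
open Literature.MathematicalPhysics.QuantumFieldTheory
open Literature.MathematicalPhysics.QuantumFieldTheory.Balaban1983to89
open Literature.MathematicalPhysics.QuantumFieldTheory.Balaban1983to89.Beta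
open ExpKernelCalculus (MKer)
open B5Prop11Plancherel (fine)
open B6Lemma24Torus (pbox mem_pbox)
open AffineAveraging (Site box toSite unitVec)
open AveragingHessianKernelsRooted (vhSAt)
open AveragingMixedJetTables (vh₂SAt)
open OneStepResolventKernel (Fib)
open B4TorusKernel.MultiPeriod (translate)
open Summit.QuantumFields.BalabanUV.Beta.BorderedHessian (bhKStepAt stepScale stepScale_ne_zero)
open Summit.QuantumFields.BalabanUV.Beta.FP.KernelPeriodisationFib (Idx perF)
open Summit.QuantumFields.BalabanUV.Beta.FP.KernelPeriodisationFibLoc (dper)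
open Summit.QuantumFields.BalabanUV.Beta.FP.TorusGaugeCovariance (tdelta tgrad)
open Summit.QuantumFields.BalabanUV.Beta.FP.TorusGaugeCovariancePairing (wrapPt wrapPt_of_mem)
open Summit.QuantumFields.BalabanUV.Beta.FP.TorusGaugeCovarianceCoarse (coarsePt)
open Summit.QuantumFields.BalabanUV.Beta.FP.PeriodisedBorderWardContactTwo (submatrix_borderT2_mul_tgrad)
open Summit.QuantumFields.BalabanUV.Beta.FP.TorusCompositeObjects
open Summit.QuantumFields.BalabanUV.Beta.FP.TorusCompositeCovariance (rootPt wrapPt_coarsePt_add_add)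
open Summit.QuantumFields.BalabanUV.Beta.FP.TorusCompositeCovarianceOne (stepIns₁ tdelta_wrapPt)

variable {d : ℕ}

section OneStep

variable (M : Fin (d + 1) → ℕ) [∀ μ, NeZero (M μ)] (Lc : ℕ) [NeZero Lc] {r : Fin (d + 1) → ℕ}

/-- [our object — bookkeeping] **THE ONE-STEP SECOND-ORDER INSERTION JET ALONG A BOND WEIGHT `w`** of the rooted averaging `M ← fine Lc M` (root `toSite r`):
`Σ_b Σ_{b′} (w b · w b′) •` the SYMMETRISED rooted packed pair `½(vh₂SAt ρ b b′_n + vh₂SAt ρ b′_n b)` of an1's second-order border table, periodised in its second bond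
(`b′_n = b′ + M∘n`) and on the fine torus, read on ((coarse multiplier slots at `coarsePt`, `inr`), (fine field slots, `inl`)) — C1's slot maps, one order up; level-free. -/
def stepIns₂ (r : Fin (d + 1) → ℕ) (w : ↥(pbox (fine Lc M)) × Fin (d + 1) → ℝ) :
    Matrix (↥(pbox M) × Fin (d + 1)) (↥(pbox (fine Lc M)) × Fin (d + 1)) ℝ :=
  ∑ b : ↥(pbox (fine Lc M)) × Fin (d + 1), ∑ b' : ↥(pbox (fine Lc M)) × Fin (d + 1), (w b * w b') •
    (perF (fine Lc M) (dper (fine Lc M) (fun x z a c => ∑' n : Site (d + 1), (1 / 2 : ℝ) *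
        (vh₂SAt (toSite r) Lc b.2 (b.1 : Site (d + 1)) b'.2 (translate (fine Lc M) (b'.1 : Site (d + 1)) n) x z a c
          + vh₂SAt (toSite r) Lc b'.2 (translate (fine Lc M) (b'.1 : Site (d + 1)) n) b.2 (b.1 : Site (d + 1)) x z a c)))).submatrix
      (fun a : ↥(pbox M) × Fin (d + 1) => ((coarsePt M Lc a.1, Sum.inr a.2) : Idx (fine Lc M) (Fib d)))
      (fun c : ↥(pbox (fine Lc M)) × Fin (d + 1) => ((c.1, Sum.inl c.2) : Idx (fine Lc M) (Fib d)))

omit [∀ μ, NeZero (M μ)] in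
/-- [folklore] C1's first-order jet entrywise: `(stepIns₁ w)(a, c) = Σ_b w b · M^{b}(a, c)`, `M^{b}` the rooted torus member of the bond `b`. -/
theorem stepIns₁_apply (r : Fin (d + 1) → ℕ) (w : ↥(pbox (fine Lc M)) × Fin (d + 1) → ℝ) (a : ↥(pbox M) × Fin (d + 1)) (c : ↥(pbox (fine Lc M)) × Fin (d + 1)) :
    stepIns₁ M Lc r w a c = ∑ b : ↥(pbox (fine Lc M)) × Fin (d + 1),
      w b * perF (fine Lc M) (dper (fine Lc M) (vhSAt (toSite r) d Lc rfl b.2 (b.1 : Site (d + 1)))) (coarsePt M Lc a.1, Sum.inr a.2) (c.1, Sum.inl c.2) := by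
  rw [stepIns₁, Matrix.sum_apply]
  exact Finset.sum_congr rfl fun b _ => by rw [Matrix.smul_apply, smul_eq_mul, Matrix.submatrix_apply]

omit [∀ μ, NeZero (M μ)] [NeZero Lc] in
/-- [folklore] two torus bonds are equal iff their (direction, site) pairs are (any torus `A`). -/
theorem ite_bond_eq {A : Fin (d + 1) → ℕ} (b b' : ↥(pbox A) × Fin (d + 1)) :
    (if (b.2, (b.1 : Site (d + 1))) = (b'.2, (b'.1 : Site (d + 1))) then (1 : ℝ) else 0) = if b = b' then (1 : ℝ) else 0 := by
  by_cases hb : b = b'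
  · subst hb; rw [if_pos rfl, if_pos rfl]
  · rw [if_neg hb, if_neg fun e => hb ?_]
    obtain ⟨h2, h1⟩ := Prod.mk.inj e
    exact Prod.ext (Subtype.ext h1) h2

/-- [folklore] **THE PER-PAIR ENTRY OF THE BI-MEMBER AGAINST THE FINE GRADIENT** (`FP/PeriodisedBorderWardContactTwo.submatrix_borderT2_mul_tgrad` at C1's slot maps, the
far root named by `rootPt` as in C1): `(T^{b,b′}·D)(a, s) = [s ≡ b′₊]·M^{b}(a,b′) + [s ≡ b₊]·M^{b′}(a,b) − [b = b′][s ≡ b₊]·c_ℓ·Qstep(a,b)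
+ [s = rootPt(a.1 + e_{a.2})]·(c_ℓ Qstep(a,b))·(c_ℓ Qstep(a,b′))`. -/
theorem pair_mul_tgrad_apply (hr : r ∈ box (d + 1) Lc) (ℓ : ℕ) (b b' : ↥(pbox (fine Lc M)) × Fin (d + 1)) (a : ↥(pbox M) × Fin (d + 1)) (s : ↥(pbox (fine Lc M))) :
    ((perF (fine Lc M) (dper (fine Lc M) (fun x z a c => ∑' n : Site (d + 1), (1 / 2 : ℝ) *
        (vh₂SAt (toSite r) Lc b.2 (b.1 : Site (d + 1)) b'.2 (translate (fine Lc M) (b'.1 : Site (d + 1)) n) x z a c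
          + vh₂SAt (toSite r) Lc b'.2 (translate (fine Lc M) (b'.1 : Site (d + 1)) n) b.2 (b.1 : Site (d + 1)) x z a c)))).submatrix
          (fun a : ↥(pbox M) × Fin (d + 1) => ((coarsePt M Lc a.1, Sum.inr a.2) : Idx (fine Lc M) (Fib d)))
          (fun c : ↥(pbox (fine Lc M)) × Fin (d + 1) => ((c.1, Sum.inl c.2) : Idx (fine Lc M) (Fib d)))
        * (tgrad (fine Lc M)).submatrix (fun b : ↥(pbox (fine Lc M)) × Fin (d + 1) => ((b.1, Sum.inl b.2) : Idx (fine Lc M) (Fib d))) id) a s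
      = tdelta (fine Lc M) ((b'.1 : Site (d + 1)) + unitVec b'.2) s
            * perF (fine Lc M) (dper (fine Lc M) (vhSAt (toSite r) d Lc rfl b.2 (b.1 : Site (d + 1)))) (coarsePt M Lc a.1, Sum.inr a.2) (b'.1, Sum.inl b'.2)
        + tdelta (fine Lc M) ((b.1 : Site (d + 1)) + unitVec b.2) s
            * perF (fine Lc M) (dper (fine Lc M) (vhSAt (toSite r) d Lc rfl b'.2 (b'.1 : Site (d + 1)))) (coarsePt M Lc a.1, Sum.inr a.2) (b.1, Sum.inl b.2)
        - tdelta (fine Lc M) ((b.1 : Site (d + 1)) + unitVec b.2) s * ((if b = b' then (1 : ℝ) else 0) * ((((Lc : ℝ) ^ (d + 1) * stepScale d Lc ℓ)⁻¹) * Qstep Lc M ℓ r a b))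
        + tdelta (fine Lc M) ((rootPt M Lc hr (wrapPt M ((a.1 : Site (d + 1)) + unitVec a.2)) : ↥(pbox (fine Lc M))) : Site (d + 1)) s
            * (((((Lc : ℝ) ^ (d + 1) * stepScale d Lc ℓ)⁻¹) * Qstep Lc M ℓ r a b) * ((((Lc : ℝ) ^ (d + 1) * stepScale d Lc ℓ)⁻¹) * Qstep Lc M ℓ r a b')) := by
  rw [submatrix_borderT2_mul_tgrad (M := fine Lc M) (M' := M) hr b'.2 (b'.1 : Site (d + 1)) (fun i => rfl)
      (V := fun κ u x z a c => ∑' n : Site (d + 1), (1 / 2 : ℝ) *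
        (vh₂SAt (toSite r) Lc κ u b'.2 (translate (fine Lc M) (b'.1 : Site (d + 1)) n) x z a c
          + vh₂SAt (toSite r) Lc b'.2 (translate (fine Lc M) (b'.1 : Site (d + 1)) n) κ u x z a c)) rfl b'.1.2 ℓ
      (fun a : ↥(pbox M) × Fin (d + 1) => (coarsePt M Lc a.1 : Site (d + 1))) (fun a => (coarsePt M Lc a.1).2) (fun a : ↥(pbox M) × Fin (d + 1) => a.2) id b.2 b.1 a s,
    ite_bond_eq, ← tdelta_wrapPt (fine Lc M) ((coarsePt M Lc a.1 : Site (d + 1)) + toSite r + (Lc : ℤ) • unitVec a.2), wrapPt_coarsePt_add_add M Lc hr]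
  rfl

omit [∀ μ, NeZero (M μ)] [NeZero Lc] in
/-- [folklore] **the finite algebra of the one-step second-order law**: with `P b b′ = M^{b}(a,b′)`, `q b = Qstep(a,b)`, `τ b` the tip indicator of `b` at the column and
`ρ` the far-root indicator, the two `b ↔ b′`-symmetric tip terms give `2·Σ_{b′} (Σ_b h b·P b b′)·(h b′·τ b′)`, the diagonal gives `−c·Σ_b q b·(h b·h b·τ b)`, the far root
the square `c²·(Σ_b q b·h b)²·ρ`. -/
theorem step_entry_algebra {β : Type*} [Fintype β] [DecidableEq β] (h τ q : β → ℝ) (P : β → β → ℝ) (c ρ : ℝ) :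
    (∑ b, ∑ b', h b * h b' * (τ b' * P b b' + τ b * P b' b - τ b * ((if b = b' then (1 : ℝ) else 0) * (c * q b)) + ρ * ((c * q b) * (c * q b'))))
      = 2 * (∑ b', (∑ b, h b * P b b') * (h b' * τ b')) - c * (∑ b, q b * (h b * h b * τ b)) + c ^ 2 * ((∑ b, q b * h b) ^ 2 * ρ) := by
  have hd : ∀ b, ∑ b', h b * h b' * (τ b * ((if b = b' then (1 : ℝ) else 0) * (c * q b))) = c * (q b * (h b * h b * τ b)) := fun b => by
    rw [Finset.sum_eq_single b (fun b' _ hb' => by rw [if_neg (Ne.symm hb')]; ring) (fun hb => absurd (Finset.mem_univ b) hb), if_pos rfl]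
    ring
  have hsq : ∑ b, ∑ b', h b * h b' * (ρ * ((c * q b) * (c * q b'))) = c ^ 2 * ((∑ b, q b * h b) ^ 2 * ρ) := by
    have e : ∀ b, ∑ b', h b * h b' * (ρ * ((c * q b) * (c * q b'))) = (ρ * c ^ 2 * (q b * h b)) * ∑ b', q b' * h b' := fun b => by
      rw [Finset.mul_sum]; exact Finset.sum_congr rfl fun b' _ => by ring
    rw [Finset.sum_congr rfl fun b _ => e b, ← Finset.sum_mul, ← Finset.mul_sum, sq]; ring
  have e2 : ∑ b, ∑ b', h b * h b' * (τ b * P b' b) = ∑ b, ∑ b', h b * h b' * (τ b' * P b b') := by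
    rw [Finset.sum_comm]
    exact Finset.sum_congr rfl fun b _ => Finset.sum_congr rfl fun b' _ => by ring
  have e3 : ∑ b', (∑ b, h b * P b b') * (h b' * τ b') = ∑ b, ∑ b', h b * h b' * (τ b' * P b b') := by
    rw [Finset.sum_comm]
    refine Finset.sum_congr rfl fun b' _ => ?_
    rw [Finset.sum_mul]
    exact Finset.sum_congr rfl fun b _ => by ring
  simp only [mul_add, mul_sub, Finset.sum_add_distrib, Finset.sum_sub_distrib, hd, hsq, e2, e3, ← Finset.mul_sum]
  ring

/-- [folklore] **`stepIns₂_mul_tgrad` — THE ONE-STEP SECOND-ORDER COVARIANCE LAW ON ALL GAUGE COLUMNS** (`r ∈ box`, ANY level `ℓ` on the right — `c_ℓ • Qstep_ℓ` is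
level-free): `stepIns₂ w · D_fine = 2 • (stepIns₁ w · Tip(w)) − c_ℓ • (Qstep · Tip(w⊙w)) + c_ℓ² • Far((Qstep w)⊙(Qstep w))` — TWO tip contacts reading C1's first-order jet
(one per bond of the pair, equal by the symmetry of the weights), the diagonal on the SQUARED weight `Tip(w⊙w)(b, s) = (w b)² · [s ≡ b.1 + e_{b.2}]`, and the FAR-ROOT
contact `Far(v⊙v)(a, s) = (v a)² · [s = rootPt (a.1 + e_{a.2})]` on the SQUARE of the averaged weight `v = Qstep · w` (C1's letters `Tip`, `Far`, `c_ℓ = (Lc^{d+1}·stepScale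
d Lc ℓ)⁻¹`).  The order-2 twin of C1 `stepIns₁_mul_tgrad`; at the (STEP) door (`n = 0`) it is U21's row `c2` with the pure-square `Db₂` (T3) in the rooted presentation. -/
theorem stepIns₂_mul_tgrad (hr : r ∈ box (d + 1) Lc) (ℓ : ℕ) (w : ↥(pbox (fine Lc M)) × Fin (d + 1) → ℝ) :
    stepIns₂ M Lc r w * (tgrad (fine Lc M)).submatrix (fun b : ↥(pbox (fine Lc M)) × Fin (d + 1) => ((b.1, Sum.inl b.2) : Idx (fine Lc M) (Fib d))) id
      = (2 : ℝ) • (stepIns₁ M Lc r w * Matrix.of (fun (b : ↥(pbox (fine Lc M)) × Fin (d + 1)) (s : ↥(pbox (fine Lc M))) =>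
              w b * tdelta (fine Lc M) ((b.1 : Site (d + 1)) + unitVec b.2) s))
        - (((Lc : ℝ) ^ (d + 1) * stepScale d Lc ℓ)⁻¹) • (Qstep Lc M ℓ r * Matrix.of (fun (b : ↥(pbox (fine Lc M)) × Fin (d + 1)) (s : ↥(pbox (fine Lc M))) =>
              (w b * w b) * tdelta (fine Lc M) ((b.1 : Site (d + 1)) + unitVec b.2) s))
        + (((Lc : ℝ) ^ (d + 1) * stepScale d Lc ℓ)⁻¹) ^ 2 • Matrix.of (fun (a : ↥(pbox M) × Fin (d + 1)) (s : ↥(pbox (fine Lc M))) =>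
              ((Qstep Lc M ℓ r *ᵥ w) a) ^ 2
                * tdelta (fine Lc M) ((rootPt M Lc hr (wrapPt M ((a.1 : Site (d + 1)) + unitVec a.2)) : ↥(pbox (fine Lc M))) : Site (d + 1)) s) := by
  ext a s
  -- the left-hand side, pair by pair
  have hL : (stepIns₂ M Lc r w * (tgrad (fine Lc M)).submatrix (fun b : ↥(pbox (fine Lc M)) × Fin (d + 1) => ((b.1, Sum.inl b.2) : Idx (fine Lc M) (Fib d))) id) a s
      = ∑ b : ↥(pbox (fine Lc M)) × Fin (d + 1), ∑ b' : ↥(pbox (fine Lc M)) × Fin (d + 1), w b * w b'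
          * (tdelta (fine Lc M) ((b'.1 : Site (d + 1)) + unitVec b'.2) s
                * perF (fine Lc M) (dper (fine Lc M) (vhSAt (toSite r) d Lc rfl b.2 (b.1 : Site (d + 1)))) (coarsePt M Lc a.1, Sum.inr a.2) (b'.1, Sum.inl b'.2)
            + tdelta (fine Lc M) ((b.1 : Site (d + 1)) + unitVec b.2) s
                * perF (fine Lc M) (dper (fine Lc M) (vhSAt (toSite r) d Lc rfl b'.2 (b'.1 : Site (d + 1)))) (coarsePt M Lc a.1, Sum.inr a.2) (b.1, Sum.inl b.2)
            - tdelta (fine Lc M) ((b.1 : Site (d + 1)) + unitVec b.2) s * ((if b = b' then (1 : ℝ) else 0) * ((((Lc : ℝ) ^ (d + 1) * stepScale d Lc ℓ)⁻¹) * Qstep Lc M ℓ r a b))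
            + tdelta (fine Lc M) ((rootPt M Lc hr (wrapPt M ((a.1 : Site (d + 1)) + unitVec a.2)) : ↥(pbox (fine Lc M))) : Site (d + 1)) s
                * (((((Lc : ℝ) ^ (d + 1) * stepScale d Lc ℓ)⁻¹) * Qstep Lc M ℓ r a b) * ((((Lc : ℝ) ^ (d + 1) * stepScale d Lc ℓ)⁻¹) * Qstep Lc M ℓ r a b'))) := by
    rw [stepIns₂, Matrix.sum_mul, Matrix.sum_apply]
    refine Finset.sum_congr rfl fun b _ => ?_
    rw [Matrix.sum_mul, Matrix.sum_apply]
    refine Finset.sum_congr rfl fun b' _ => ?_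
    rw [Matrix.smul_mul, Matrix.smul_apply, smul_eq_mul, pair_mul_tgrad_apply M Lc hr ℓ b b' a s]
  -- the right-hand side, entrywise
  have hR : ((2 : ℝ) • (stepIns₁ M Lc r w * Matrix.of (fun (b : ↥(pbox (fine Lc M)) × Fin (d + 1)) (s : ↥(pbox (fine Lc M))) =>
              w b * tdelta (fine Lc M) ((b.1 : Site (d + 1)) + unitVec b.2) s))
        - (((Lc : ℝ) ^ (d + 1) * stepScale d Lc ℓ)⁻¹) • (Qstep Lc M ℓ r * Matrix.of (fun (b : ↥(pbox (fine Lc M)) × Fin (d + 1)) (s : ↥(pbox (fine Lc M))) =>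
              (w b * w b) * tdelta (fine Lc M) ((b.1 : Site (d + 1)) + unitVec b.2) s))
        + (((Lc : ℝ) ^ (d + 1) * stepScale d Lc ℓ)⁻¹) ^ 2 • Matrix.of (fun (a : ↥(pbox M) × Fin (d + 1)) (s : ↥(pbox (fine Lc M))) =>
              ((Qstep Lc M ℓ r *ᵥ w) a) ^ 2
                * tdelta (fine Lc M) ((rootPt M Lc hr (wrapPt M ((a.1 : Site (d + 1)) + unitVec a.2)) : ↥(pbox (fine Lc M))) : Site (d + 1)) s)) a s
      = 2 * (∑ b' : ↥(pbox (fine Lc M)) × Fin (d + 1), (∑ b : ↥(pbox (fine Lc M)) × Fin (d + 1),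
              w b * perF (fine Lc M) (dper (fine Lc M) (vhSAt (toSite r) d Lc rfl b.2 (b.1 : Site (d + 1)))) (coarsePt M Lc a.1, Sum.inr a.2) (b'.1, Sum.inl b'.2))
            * (w b' * tdelta (fine Lc M) ((b'.1 : Site (d + 1)) + unitVec b'.2) s))
        - (((Lc : ℝ) ^ (d + 1) * stepScale d Lc ℓ)⁻¹) * (∑ b : ↥(pbox (fine Lc M)) × Fin (d + 1), Qstep Lc M ℓ r a b * (w b * w b * tdelta (fine Lc M) ((b.1 : Site (d + 1)) + unitVec b.2) s))
        + (((Lc : ℝ) ^ (d + 1) * stepScale d Lc ℓ)⁻¹) ^ 2 * ((∑ b : ↥(pbox (fine Lc M)) × Fin (d + 1), Qstep Lc M ℓ r a b * w b) ^ 2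
            * tdelta (fine Lc M) ((rootPt M Lc hr (wrapPt M ((a.1 : Site (d + 1)) + unitVec a.2)) : ↥(pbox (fine Lc M))) : Site (d + 1)) s) := by
    simp only [Matrix.add_apply, Matrix.sub_apply, Matrix.smul_apply, Matrix.mul_apply, Matrix.of_apply, smul_eq_mul, stepIns₁_apply, Matrix.mulVec, dotProduct]
  rw [hL, hR]
  exact step_entry_algebra w (fun b => tdelta (fine Lc M) ((b.1 : Site (d + 1)) + unitVec b.2) s) (fun b => Qstep Lc M ℓ r a b)
    (fun b b' => perF (fine Lc M) (dper (fine Lc M) (vhSAt (toSite r) d Lc rfl b.2 (b.1 : Site (d + 1)))) (coarsePt M Lc a.1, Sum.inr a.2) (b'.1, Sum.inl b'.2))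
    (((Lc : ℝ) ^ (d + 1) * stepScale d Lc ℓ)⁻¹)
    (tdelta (fine Lc M) ((rootPt M Lc hr (wrapPt M ((a.1 : Site (d + 1)) + unitVec a.2)) : ↥(pbox (fine Lc M))) : Site (d + 1)) s)

end OneStep

end Summit.QuantumFields.BalabanUV.Beta.FP.TorusCompositeCovarianceTwoStep

end
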